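/-
Copyright (c) 2026 the pub-hodgecm-mathlib formalisation cell (harness21).  Prover seat hodgecm-mathlib-K2E3-p03 (g5), Track B «K2-LIT» ∕ h413
(`stmt-HodgeConjecture-24833`), line `K2_E3_EllipticInputs`, road (11-3-split-nsc), leaf (nsc-S-A′) `sig_K2E3GL3PrincipalBlockStandardSpan` (owner K2E3-p25 (g0)),
brick G1 (dealer K2E3-plan (g4) D64), FILE 2 OF 3: THE OPEN-CELL PART OF THE JACQUET MODULE OF `Ind_{Q_{1,1}}^{GL₂} σ'` HAS DIMENSION AT MOST `dim W`.
2026-09-04.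
-/
import Literature.NumberTheory.Automorphic.PrincipalSeriesGL2WeylSymmetry    -- ★ brings `RankTwoUnitShell`, `JacquetOfInducedMaximalParabolic`, `OpenCellCoinvariants`
import Literature.NumberTheory.Automorphic.OpenCellCoinvariants               -- ★ `openCellSubrep`, `mk_mem_span_range_mk_cellSection`
import HarnessLib

/-!
# K2_E3 road (h413), leaf (nsc-S-A′), brick G1 (file 2 of 3): `dim [I_open] ≤ dim W` in the Jacquet module of `Ind_{Q_{1,1}}^{GL₂(F)} σ'`
# (`lastBlockLabel 2` currency) — the open orbit of the geometric lemma as an UPPER BOUND, measure-free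

Cell `pub/hodgecm-mathlib` (D-0151), Track B, seat K2E3-p03 (g5); leaf owner K2E3-p25 (g0).  `--supports stmt-HodgeConjecture-24833 --as helper`; THEOREMS ONLY
(no definition ∕ instance ∕ notation ∕ named fact ∕ `sorry`); never imports `Cruxes/…/Lines`.  COUNT-NEUTRAL helper.  GENERIC in the coefficient space `W` of
the smooth inducing representation `σ'` of `P = Q_{1,1} = standardParabolicGL F (lastBlockLabel 2)` (file 3 specialises to `σ'_{x,y}`, `W = ℂ`).

OBJECTS (inline).  `I = Ind_P^{GL₂} σ'` (★ `smoothIndRep`), `J = (restrictUnipotentGL F (lastBlockLabel 2) I).Coinvariants` (the `U_c`-coinvariants, carrier of ★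
`jacquetGL` ∕ ★ `normalizedJacquetGL`), `I_open = vanishingOn P σ' (cellLT (lastBlockLabel 2) w₀)` (functions vanishing on the closed cell `P`), `[I_open] = map mk I_open`,
and the standard sections `Φ_{K₀,w}` (★ `cellSection`, `cellSectionₗ`) for a compact open subgroup `K₀` of `N' = oppositeCellRadical (lastBlockLabel 2)`.

THE RESULTS.
* §1 **`mk_mem_range_cellSection_of_mem_vanishingOn`** — for `f ∈ I_open`, `[f] ∈ range ([·] ∘ Φ_{K₀,·})`: the `lastBlockLabel 2` port of ★
  `PrincipalSeriesGL2JacquetModule.mk_mem_range_of_toFun_one_eq_zero` (the `id`-labelled Borel): ★ `mk_mem_span_range_mk_cellSection` (the classes `[Φ_{K₀,w}]`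
  span the `ψ = 1`-twisted `U₂`-coinvariants of `I_open`) pushed to `J` through the comparison map `(I_open)_{U₂,1} → J` (well defined because `U₂ = U_c` for
  `GL₂`, ★ `mem_unipotentRadicalGL_of_mem_upperUnitriangular_two`, ★ `mk_smoothIndRep_eq_of_mem_unipotentRadicalGL`).
* §2 **`finrank_map_mk_vanishingOn_le`** — `[I_open]` is finite-dimensional with `finrank [I_open] ≤ finrank W` (the congruence box `N' ∩ K_1` ★
  `isOpen_comap_congruenceGL` ∕ `isCompact_comap_congruenceGL` as `K₀`).
[BernsteinZelevinsky1977, Geometrical Lemma 2.12 and Thm. 5.2 (open orbit: `(I_open)_U ≅ i ∘ w₀ ∘ r`, here a quotient of `W`); Casselman1995, §6.3, Lemma 7.1.1 (a);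
Bump1997, §4.5]
HONEST LABEL: HC_CM is proved only modulo the 7 printed citations (2 remaining named inputs: hLiu418 = stmt-HodgeConjecture-24832, h413 = stmt-HodgeConjecture-24833)
until rung 0 closes; count-neutral helper.

## References
* [BernsteinZelevinsky1977] I. N. Bernstein, A. V. Zelevinsky, *Induced representations of reductive 𝔭-adic groups I*, Ann. Sci. ÉNS 10 (1977), Geometrical Lemma
  2.12, Thm. 5.2, §7.1.
* [Casselman1995] W. Casselman, *Introduction to the theory of admissible representations of 𝔭-adic reductive groups* (draft 1995), §6.3, Lemma 7.1.1.
* [Bump1997] D. Bump, *Automorphic Forms and Representations* (1997), §4.5.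
-/

set_option autoImplicit false
set_option linter.dupNamespace false

noncomputable section

open Matrix
open scoped MatrixGroups
open Literature.NumberTheory.Automorphic Literature.NumberTheory.Automorphic.Zelevinsky1980 ValuativeRel

namespace Summit.HodgeConjecture.HodgeConjecture.Cruxes.H413.K2E3GL2JacquetModuleDimension

universe u

variable {F : Type u} [Field F] [ValuativeRel F] [TopologicalSpace F] [IsNonarchimedeanLocalField F]
  {W : Type*} [AddCommGroup W] [Module ℂ W] (σ' : Representation ℂ ↥(standardParabolicGL F (lastBlockLabel 2)) W)

/-! ## §1  The classes of `I_open` lie in the range of `w ↦ [Φ_{K₀,w}]` -/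

/-- **`[f] ∈ range ([·] ∘ Φ_{K₀,·})` for `f ∈ I_open`** (in the `U_c`-coinvariants `J` of `Ind_{Q_{1,1}}^{GL₂} σ'`): the classes `[Φ_{K₀,w}]`, `w ∈ W`, span the
`ψ = 1`-twisted `U₂`-coinvariants of `I_open` (★ `mk_mem_span_range_mk_cellSection`), and the inclusion `I_open ≤ I` descends to a comparison map
`(I_open)_{U₂,1} → J` since `U₂ = U_c` acts trivially on `J` (★ `mem_unipotentRadicalGL_of_mem_upperUnitriangular_two`, ★ `mk_smoothIndRep_eq_of_mem_unipotentRadicalGL`).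
[cite: BernsteinZelevinsky1977, Thm. 5.2 (open orbit)] [cite: Casselman1995, Lemma 7.1.1 (a)] -/
theorem mk_mem_range_cellSection_of_mem_vanishingOn (hσ' : σ'.IsSmooth)
    (K₀ : Subgroup ↥(oppositeCellRadical (K := F) (lastBlockLabel 2))) (hK₀o : IsOpen (K₀ : Set ↥(oppositeCellRadical (K := F) (lastBlockLabel 2))))
    (hK₀c : IsCompact (K₀ : Set ↥(oppositeCellRadical (K := F) (lastBlockLabel 2))))
    (f : Representation.SmoothInd (standardParabolicGL F (lastBlockLabel 2)) σ')
    (hf : f ∈ vanishingOn (standardParabolicGL F (lastBlockLabel 2)) σ' (cellLT (K := F) (lastBlockLabel 2) Fin.revPerm)) :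
    Representation.Coinvariants.mk (Representation.restrictUnipotentGL F (lastBlockLabel 2)
        (Representation.smoothIndRep (standardParabolicGL F (lastBlockLabel 2)) σ')) f ∈
      LinearMap.range (Representation.Coinvariants.mk (Representation.restrictUnipotentGL F (lastBlockLabel 2)
          (Representation.smoothIndRep (standardParabolicGL F (lastBlockLabel 2)) σ')) ∘ₗ
        cellSectionₗ σ' (monotone_lastBlockLabel 2) hσ' K₀ hK₀o hK₀c) := by
  have hθ : ∀ x ∈ K₀, whittakerCharFun (1 : AddChar F Circle) (radicalToUpper (c := lastBlockLabel 2) (monotone_lastBlockLabel 2) x) = 1 :=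
    fun x _ => by rw [whittakerCharFun_apply, AddChar.one_apply, Circle.coe_one]
  have hspan := mk_mem_span_range_mk_cellSection (σ' := σ') (1 : AddChar F Circle) (monotone_lastBlockLabel 2) hσ' K₀ hK₀o hK₀c hθ f hf
  -- the comparison map `Θ : (I_open)_{U₂,1} → J`
  have hcomp : ∀ u : ↥(upperUnitriangular (Fin 2) F),
      ((Representation.Coinvariants.mk (Representation.restrictUnipotentGL F (lastBlockLabel 2)
          (Representation.smoothIndRep (standardParabolicGL F (lastBlockLabel 2)) σ'))) ∘ₗ
          (openCellSubrep (lastBlockLabel 2) σ' (1 : AddChar F Circle)).toSubmodule.subtype) ∘ₗ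
        (openCellSubrep (lastBlockLabel 2) σ' (1 : AddChar F Circle)).toRepresentation u =
      (Representation.Coinvariants.mk (Representation.restrictUnipotentGL F (lastBlockLabel 2)
          (Representation.smoothIndRep (standardParabolicGL F (lastBlockLabel 2)) σ'))) ∘ₗ
          (openCellSubrep (lastBlockLabel 2) σ' (1 : AddChar F Circle)).toSubmodule.subtype := by
    intro u
    refine LinearMap.ext fun z => ?_
    have hval : (((openCellSubrep (lastBlockLabel 2) σ' (1 : AddChar F Circle)).toRepresentation u z :
        ↥(openCellSubrep (lastBlockLabel 2) σ' (1 : AddChar F Circle)).toSubmodule) :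
          Representation.SmoothInd (standardParabolicGL F (lastBlockLabel 2)) σ') =
        Representation.smoothIndRep (standardParabolicGL F (lastBlockLabel 2)) σ' (u : GL (Fin 2) F) z := by
      change whittakerTwist (Representation.smoothIndRep (standardParabolicGL F (lastBlockLabel 2)) σ') (1 : AddChar F Circle) u
        (z : Representation.SmoothInd (standardParabolicGL F (lastBlockLabel 2)) σ') = _
      rw [whittakerTwist_apply, whittakerCharFun_apply, AddChar.one_apply, Circle.coe_one, inv_one, one_smul]
    simp only [LinearMap.coe_comp, Function.comp_apply, Submodule.coe_subtype]
    rw [hval]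
    exact mk_smoothIndRep_eq_of_mem_unipotentRadicalGL (n := 0) σ' (mem_unipotentRadicalGL_of_mem_upperUnitriangular_two u.2) _
  set Θ := Representation.Coinvariants.lift (openCellSubrep (lastBlockLabel 2) σ' (1 : AddChar F Circle)).toRepresentation
    ((Representation.Coinvariants.mk (Representation.restrictUnipotentGL F (lastBlockLabel 2)
        (Representation.smoothIndRep (standardParabolicGL F (lastBlockLabel 2)) σ'))) ∘ₗ
      (openCellSubrep (lastBlockLabel 2) σ' (1 : AddChar F Circle)).toSubmodule.subtype) hcomp with hΘ
  have hΘmk : ∀ z, Θ (Representation.Coinvariants.mk (openCellSubrep (lastBlockLabel 2) σ' (1 : AddChar F Circle)).toRepresentation z) =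
      Representation.Coinvariants.mk (Representation.restrictUnipotentGL F (lastBlockLabel 2)
        (Representation.smoothIndRep (standardParabolicGL F (lastBlockLabel 2)) σ'))
          (z : Representation.SmoothInd (standardParabolicGL F (lastBlockLabel 2)) σ') :=
    fun z => Representation.Coinvariants.lift_mk _ _ _ _
  have himg := Submodule.mem_map_of_mem (f := Θ) hspan
  rw [hΘmk, Submodule.map_span, ← Set.range_comp] at himg
  refine (Submodule.span_le.2 ?_) himg
  rintro _ ⟨w, rfl⟩
  rw [SetLike.mem_coe, Function.comp_apply, hΘmk]
  exact LinearMap.mem_range.2 ⟨w, rfl⟩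

/-! ## §2  `dim [I_open] ≤ dim W` -/

/-- **THE OPEN-CELL BOUND**: the image `[I_open]` of the open-cell part in the Jacquet module `J` of `Ind_{Q_{1,1}}^{GL₂(F)} σ'` is finite-dimensional with
`finrank [I_open] ≤ finrank W` — it lies in the range of `w ↦ [Φ_{K₀,w}]` for the congruence box `K₀ = N' ∩ K_1` (§1).  For a character (`W = ℂ`):
`dim [I_open] ≤ 1`. [cite: BernsteinZelevinsky1977, Geometrical Lemma 2.12 and Thm. 5.2] [cite: Casselman1995, §6.3 and Lemma 7.1.1 (a)] -/
theorem finrank_map_mk_vanishingOn_le [FiniteDimensional ℂ W] (hσ' : σ'.IsSmooth) :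
    FiniteDimensional ℂ ↥(Submodule.map (Representation.Coinvariants.mk (Representation.restrictUnipotentGL F (lastBlockLabel 2)
        (Representation.smoothIndRep (standardParabolicGL F (lastBlockLabel 2)) σ')))
          (vanishingOn (standardParabolicGL F (lastBlockLabel 2)) σ' (cellLT (K := F) (lastBlockLabel 2) Fin.revPerm))) ∧
      Module.finrank ℂ ↥(Submodule.map (Representation.Coinvariants.mk (Representation.restrictUnipotentGL F (lastBlockLabel 2)
          (Representation.smoothIndRep (standardParabolicGL F (lastBlockLabel 2)) σ')))
            (vanishingOn (standardParabolicGL F (lastBlockLabel 2)) σ' (cellLT (K := F) (lastBlockLabel 2) Fin.revPerm))) ≤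
        Module.finrank ℂ W := by
  have hK₀o := isOpen_comap_congruenceGL (F := F) (γ := (1 : ValueGroupWithZero F)) one_ne_zero (N := 2)
  have hK₀c := isCompact_comap_congruenceGL (F := F) (1 : ValueGroupWithZero F) (N := 2)
  have hle : Submodule.map (Representation.Coinvariants.mk (Representation.restrictUnipotentGL F (lastBlockLabel 2)
        (Representation.smoothIndRep (standardParabolicGL F (lastBlockLabel 2)) σ')))
          (vanishingOn (standardParabolicGL F (lastBlockLabel 2)) σ' (cellLT (K := F) (lastBlockLabel 2) Fin.revPerm)) ≤
      LinearMap.range (Representation.Coinvariants.mk (Representation.restrictUnipotentGL F (lastBlockLabel 2)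
          (Representation.smoothIndRep (standardParabolicGL F (lastBlockLabel 2)) σ')) ∘ₗ
        cellSectionₗ σ' (monotone_lastBlockLabel 2) hσ' _ hK₀o hK₀c) := by
    rintro _ ⟨f, hf, rfl⟩
    exact mk_mem_range_cellSection_of_mem_vanishingOn σ' hσ' _ hK₀o hK₀c f hf
  haveI : FiniteDimensional ℂ ↥(LinearMap.range (Representation.Coinvariants.mk (Representation.restrictUnipotentGL F (lastBlockLabel 2)
          (Representation.smoothIndRep (standardParabolicGL F (lastBlockLabel 2)) σ')) ∘ₗ
        cellSectionₗ σ' (monotone_lastBlockLabel 2) hσ' _ hK₀o hK₀c)) :=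
    LinearMap.finiteDimensional_range _
  exact ⟨Submodule.finiteDimensional_of_le hle, (Submodule.finrank_mono hle).trans (LinearMap.finrank_range_le _)⟩

end Summit.HodgeConjecture.HodgeConjecture.Cruxes.H413.K2E3GL2JacquetModuleDimension

end
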